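import Literature.NumberTheory.EllipticCurves.CyclotomicIwasawaMainTheoremIrreducibleBaseChangeProofs
import Literature.NumberTheory.EllipticCurves.QuadraticTwistJInvariantProofs
import Literature.NumberTheory.EllipticCurves.QuadraticTwistPadicReduction
import HarnessLib

/-!
# Route `QuadraticBranchSignedControl` (rung K8, cell `bsd-potss`) — TOOL: every curve `V/ℚ` is the
# `d`-twist of a GLOBALLY MINIMAL curve `W` (`C • W^{(d)} = V`), in particular of a globally minimal
# `p*`-partner (seat `bsd-potss-k8q-c2` g5; route-free)

WHY. The K8 items on the even main conjecture at `η` — 19114 `PlusMainConjectureBranch`, 19601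
`PlusEtaLowerInclusion`, 19606 `PlusEtaMainConjectureNonsurj` and their registered stubs — quantify over
the GOOD twist `V` (`p ≥ 5`, good at `p`, `a_p(V) = 0`), while every census row, every per-row record and
every analytic-rank split (`L(W,1) ≠ 0` / `r_an(W) = 1`) is stated on the ADDITIVE partner `W` with
`C • W^{(p*)} = V` (`p* = (-1)^{(p-1)/2} p`), `W` globally minimal (the binders of 19606's v3 stubs
`stub_etaMC_r0_mu` / `stub_etaMC_r0_lowerBSD`, of k8eta-c2's unit records, of ctrl's converse roads, of
this seat's CM files). Going from a `V`-statement to the `W`-side case split needs the EXISTENCE of such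
a partner for a GIVEN `V`; the tree had only the opposite direction
(`exists_isGloballyMinimal_smul_eq_quadraticTwist`: a globally minimal model OF the twist `V^{(d)}`).
This file supplies it: twist `V` by `d`, take a globally minimal model `W` of `V^{(d)}`, and untwist —
`(V^{(d)})^{(d)} = V^{(d²)} ≅ V` over `ℚ` (`quadraticTwist_quadraticTwist`,
`exists_variableChange_smul_eq_quadraticTwist_sq`), transported along `W ≅ V^{(d)}` by
`quadraticTwist_smul`. Elementary (Silverman AEC X.5 Cor. 5.4 (iii), VIII.8 Cor. 8.3); no named fact,
no definition, no `sorry`, axioms standard; nothing booked. `--supports stmt-BirchSwinnertonDyer-19114`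
(consumed by the companion file `…PlusMainConjectureBranchCMRung`).

References: [SilvermanAEC2009] X.5 Cor. 5.4 (iii) (twists by squares are isomorphic), VIII.8 Cor. 8.3
(global minimal models over `ℚ`).
-/

set_option autoImplicit false
set_option linter.dupNamespace false

namespace Summit.BirchSwinnertonDyer.BirchSwinnertonDyer.Theorems

namespace TwistPartner

open WeierstrassCurve Literature.NumberTheory.EllipticCurves

/-- **Every elliptic curve `V/ℚ` is the `d`-twist of a globally minimal curve** (`d ≠ 0`): there are a
globally minimal elliptic `W/ℚ` and a change of variables `C` over `ℚ` with `C • W^{(d)} = V`. Proof: `W`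
:= a globally minimal model of `V^{(d)}` (`C₁ • W = V^{(d)}`); then `W^{(d)} = (C₁⁻¹ • V^{(d)})^{(d)}` is a
change of variables of `(V^{(d)})^{(d)} = V^{(d·d)}`, itself a change of variables of `V` (twist by a
non-zero square). [cite: SilvermanAEC2009, X.5 Cor. 5.4 (iii) and VIII.8 Cor. 8.3] -/
theorem exists_isGloballyMinimal_twistPartner (V : WeierstrassCurve ℚ) [V.IsElliptic] {d : ℚ}
    (hd : d ≠ 0) :
    ∃ (W : WeierstrassCurve ℚ) (_ : W.IsElliptic) (_ : W.IsGloballyMinimal) (C : VariableChange ℚ),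
      C • W.quadraticTwist d = V := by
  obtain ⟨W, hWE, hWM, C₁, hC₁⟩ := exists_isGloballyMinimal_smul_eq_quadraticTwist V hd
  -- `W = C₁⁻¹ • V^{(d)}`
  have hW : W = C₁⁻¹ • V.quadraticTwist d := by rw [← hC₁, inv_smul_smul]
  -- `(V^{(d)})^{(d)} = V^{(d²)} = C₂ • V`
  obtain ⟨C₂, hC₂⟩ := V.exists_variableChange_smul_eq_quadraticTwist_sq hd
  have hVV : (V.quadraticTwist d).quadraticTwist d = C₂ • V := by
    rw [quadraticTwist_quadraticTwist, ← sq, hC₂]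
  refine ⟨W, hWE, hWM, ((⟨(C₁⁻¹).u, d * (C₁⁻¹).r, 0, 0⟩ : VariableChange ℚ) * C₂)⁻¹, ?_⟩
  rw [hW, quadraticTwist_smul, hVV, smul_smul, smul_smul, mul_assoc, inv_mul_cancel, one_smul]

/-- **The globally minimal `p*`-PARTNER of a curve `V/ℚ`** (`p` a prime; `p* = (-1)^{⌊p/2⌋} p`, the
spelling of the K8 route): there are a globally minimal elliptic `W/ℚ` and `C` with `C • W^{(p*)} = V`
— the binder shape `C • W.quadraticTwist ((-1) ^ (p / 2) * p) = V` of the cell's `W`-side statements.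
[cite: SilvermanAEC2009, X.5 Cor. 5.4 (iii) and VIII.8 Cor. 8.3] -/
theorem exists_isGloballyMinimal_pStarPartner (V : WeierstrassCurve ℚ) [V.IsElliptic] (p : ℕ)
    [hp : Fact p.Prime] :
    ∃ (W : WeierstrassCurve ℚ) (_ : W.IsElliptic) (_ : W.IsGloballyMinimal) (C : VariableChange ℚ),
      C • W.quadraticTwist ((-1) ^ (p / 2) * p) = V :=
  exists_isGloballyMinimal_twistPartner V
    (mul_ne_zero (pow_ne_zero _ (neg_ne_zero.mpr one_ne_zero)) (Nat.cast_ne_zero.mpr hp.out.ne_zero))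

end TwistPartner

end Summit.BirchSwinnertonDyer.BirchSwinnertonDyer.Theorems
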